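import Literature.Barriers.AtomisticToContinuum.DisorderedHarmonicChainTransfer
import Mathlib.Analysis.SpecialFunctions.ImproperIntegrals
import Mathlib.Analysis.SpecialFunctions.Pow.Real
import Mathlib.Analysis.Complex.ExponentialBounds
import HarnessLib

/-!
# Ajanki–Huveneers 2011, Thm 1.1, bound (H): O'Connor's Theorem 6 on the frequencies above `ω₀ > 0`

Fifth file of the Casher–Lebowitz / Ajanki–Huveneers cluster of the barrier catalogue
`Literature/Barriers/AtomisticToContinuum/` (`DisorderedHarmonicChain.lean`, `…Spectral.lean`,
`…Transfer.lean`, `…Phases.lean`). `…Transfer.lean` reduced the spectral form of Theorem 1.1 of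
O. Ajanki, F. Huveneers (CMP **301** (2011) 841–883) to three bounds (U), (H), (L) on the
mass-averaged current density `𝔼 j_n(ω)` (`clAvgCurrentDensity`); (H) =
`AjankiHuveneers2011_highFrequencyBound` (`∫_{ω₀}^∞ 𝔼 j_n ≲ e^{-c√n}` for every `ω₀ > 0`) is the
statement AH2011 take from A. J. O'Connor, CMP **45** (1975) 63–77, Theorem 6 ("the contribution
to `J_N` from frequencies above `ε` falls off exponentially with `N` for each fixed `ε > 0`";
precisely `⟨J_N(ε,∞)⟩ ≤ C(ε,λ) exp[-λa(ε)N^{1/2}]` for `N` large). This file (provefact unit for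
(H), SIZE XL) formalises the PROOF of Theorem 6 (§3 of O'Connor's paper) down to its one
random-matrix input:

* **PROVED — deterministic attenuation above the band** (O'Connor's first case, eq. (36):
  "Since each mass is greater than 1 plane waves with frequencies above 2 are exponentially
  attenuated by every chain"). In the physical variables of `clImpedance` (masses `m_k ≥ a`,
  unit springs): for `aω² ≥ 4` the diagonal symbols `d_k = 2 - m_kω²` are `≤ -2` and
  `|D_j(e₁)| ≥ (aω² - 3)^j` (`pow_le_abs_chainD₁`, from the monotone growth `ahD_growth` of the
  continuant with symbol `≥ 2`); hence `j_n ≤ ω²/D_n(e₁)² ≤ 4/(a²ω²9^{n-1})` for `aω² ≥ 6`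
  (`clCurrentDensity_le_highFreq`), `∫_{ω₁}^∞ 𝔼 j_n ≤ 4/(a²ω₁9^{n-1})` for `aω₁² ≥ 6`
  (`clAvgCurrentDensity_tail`), and `𝔼 j_n` is integrable on every `(ω₀, ∞)`, `ω₀ > 0`
  (`integrableOn_clAvgCurrentDensity_Ioi`).
* **PROVED — the band estimate from the amplitude** (O'Connor's (34) and the last display of the
  proof): `t_n² := D_n(e₁)² + D_{n-1}(e₁)² > 0` (`amp_pos`, from `det Q_n = 1`),
  `j_n ≤ max(1,ω²)/t_n²` (`clCurrentDensity_le_max_div_amp`), and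
  `𝔼 j_n(ω) ≤ ½ℙ(t_n² ≤ E) + max(1,ω²)/E` for every level `E > 0`
  (`clAvgCurrentDensity_le_of_amp`).
* **NAMED FACT — O'Connor's moderate-deviation bound (39)** for the amplitude,
  `ℙ(t_n(ω)² ≤ e^{γn}) ≤ Ce^{-α√n}` for `n ≥ N₀` uniformly on compact bands
  (`OConnor1975_amplitudeBound`); this is where Furstenberg's theorem (`γ(ω) > 0`, Thms 4–5)
  and the transfer-operator CLT with its uniform spectral gap (Thms 1–3, §3 (i)–(v)) enter.
* **PROVED — the reduction** `OConnor1975_amplitudeBound → AjankiHuveneers2011_highFrequencyBound`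
  (`AjankiHuveneers2011_highFrequencyBound_of_amplitudeBound`): band `[ω₀, ω₁]`,
  `ω₁ = max(ω₀, √(6/a))`, plus tail, plus absorption of the finitely many `n < N₀`; rate
  `c = min(α, γ, 1)`.

## Sources

* A. J. O'Connor, CMP 45 (1975) 63–77 (Project Euclid scan): §1 eqs. (4)–(6) (`t_n`, `θ_n`,
  `x_n = 2 - m_nw²`), §2 Thms 2–5, §3 eqs. (31)–(34), Thm 6 and its proof, eqs. (35)–(39).
* O. Ajanki, F. Huveneers, CMP 301 (2011) 841–883, arXiv:1003.1076: §2 ¶3 ("O'Connor has shown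
  (see Theorem 6 and its proof in [O'Connor-75]) that for any reasonable heat baths the
  frequencies above any fixed `w₀ > 0` have exponentially small contribution"), §2.2 ("By
  Theorem 6 of [O'Connor-75] we may restrict the integration domain … into `[0,w₀]`"), §6.2
  ("It has already been shown by O'Connor [O'Connor-75] that `𝒥₃ ≲ e^{-Cn^{1/2}}`").

## Design notes

* Variables: O'Connor's `w` is the physical frequency of `clImpedance` (unit springs, eq. (1)),
  his `x_n = 2 - m_nw²` is `massDiag`, and `T_n⋯T_1 e₁ = t_n(sin θ_n, cos θ_n)` (eq. (4),
  `θ₀ = π/2`, `t₀ = 1`) gives `t_n² = D_n(e₁)² + D_{n-1}(e₁)²` with `D_j(e₁) = chainD₁ m ω j`.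
  He normalises the masses to be `≥ 1` and splits at `w = 2 + δ`; with masses `≥ a` we split at
  `aω² = 6` (any level `> 4` would do; `6` makes `aω² - 3 ≥ max(3, aω²/2)`).
* The fact (39) is vendored with the growth rate `γ` existential (`γ = ½ min_{band} γ(w)` in
  the paper, `γ(w)` the Lyapunov exponent) and indexed by `k + 1` (`t_{k+1}² = D_{k+1}² + D_k²`,
  no `ℕ`-subtraction); see its docstring for the scope comparison between O'Connor's "C¹ density
  with compact support" and AH2011's `MassDensityHyp`.
* NOT here (the remaining layer below (39)): the phase chain `θ_n` and its transfer operator `T`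
  (Thm 1: compactness of `T²`, spectral gap, a.c. stationary measure), the analytic family
  `A(λ)` and the CLT (Thm 2), `σ² > 0` (Thm 3), Furstenberg's `γ > 0` (Thm 4 = Lemma 8.9 of
  Furstenberg 1963, Thm 5 = criteria (F1)/(F2) and Yoshioka's verification for transfer
  matrices), and the uniformity (i)–(v) in `w`.
-/

noncomputable section

open MeasureTheory Set Filter

namespace Literature.Barriers.AtomisticToContinuum.HeatConduction

open Literature.MathematicalPhysics.KineticTheory.HeatConduction

/-! ### Deterministic attenuation above the band (O'Connor (36)) -/

section Growth

/-- Flipping the sign of the diagonal symbol multiplies `D_n` by `(-1)^n`: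
`D_n[-d](v₀, -v₋₁) = (-1)^n D_n[d](v₀, v₋₁)`. [folklore] -/
theorem ahD_neg_symbol (d : ℕ → ℝ) (v₀ v₁ : ℝ) :
    ∀ n, ahD (fun k => -d k) v₀ (-v₁) n = (-1) ^ n * ahD d v₀ v₁ n
  | 0 => by simp
  | 1 => by simp; ring
  | n + 2 => by
    rw [ahD_add_two, ahD_add_two, ahD_neg_symbol d v₀ v₁ (n + 1), ahD_neg_symbol d v₀ v₁ n]
    ring

/-- **Monotone exponential growth outside the band.** If the diagonal symbol satisfies
`e_k ≥ q ≥ 2` for `k < N`, then `D_j(e₁) ≥ 0` and `D_{j+1}(e₁) ≥ (q - 1) D_j(e₁)` for `j < N`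
(a frequency above the top of the spectrum of every admissible periodic chain is attenuated at a
uniform rate; O'Connor: "plane waves with frequencies above 2 are exponentially attenuated by
every chain"). [cite: OConnor1975, §3 eq. (36)] -/
theorem ahD_growth {e : ℕ → ℝ} {q : ℝ} {N : ℕ} (hq : 2 ≤ q) (he : ∀ k, k < N → q ≤ e k) :
    ∀ j, j < N → 0 ≤ ahD e 1 0 j ∧ (q - 1) * ahD e 1 0 j ≤ ahD e 1 0 (j + 1)
  | 0, h => by
    refine ⟨by simp, ?_⟩
    show (q - 1) * ahD e 1 0 0 ≤ ahD e 1 0 1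
    simp only [ahD_zero, ahD_one, mul_one, sub_zero]
    linarith [he 0 h]
  | j + 1, h => by
    obtain ⟨h0, h1⟩ := ahD_growth hq he j (by omega)
    have hq1 : 1 ≤ q - 1 := by linarith
    have hpos : 0 ≤ ahD e 1 0 (j + 1) := le_trans (mul_nonneg (by linarith) h0) h1
    refine ⟨hpos, ?_⟩
    rw [ahD_add_two]
    have hej := he (j + 1) h
    have hDj : ahD e 1 0 j ≤ ahD e 1 0 (j + 1) :=
      le_trans (le_mul_of_one_le_left h0 hq1) h1
    nlinarith [mul_le_mul_of_nonneg_right hej hpos]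

/-- `D_j(e₁) ≥ (q - 1)^j` for `j ≤ N` when `e_k ≥ q ≥ 2` for `k < N`. [cite: OConnor1975, §3 eq. (36)] -/
theorem pow_le_ahD {e : ℕ → ℝ} {q : ℝ} {N : ℕ} (hq : 2 ≤ q) (he : ∀ k, k < N → q ≤ e k) :
    ∀ j, j ≤ N → (q - 1) ^ j ≤ ahD e 1 0 j
  | 0, _ => by simp
  | j + 1, h => by
    obtain ⟨-, h1⟩ := ahD_growth hq he j (by omega)
    have ih := pow_le_ahD hq he j (by omega)
    calc (q - 1) ^ (j + 1) = (q - 1) * (q - 1) ^ j := by ring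
      _ ≤ (q - 1) * ahD e 1 0 j := mul_le_mul_of_nonneg_left ih (by linarith)
      _ ≤ ahD e 1 0 (j + 1) := h1

/-- **`|D_j(e₁)(ω)| ≥ (aω² - 3)^j`** for a chain with masses `m_k ≥ a` at a frequency with
`aω² ≥ 4`: then `d_k = 2 - m_kω² ≤ -(aω² - 2) ≤ -2`, all transfer matrices are uniformly
hyperbolic with a common expanding cone, and `(-1)^j D_j(e₁)` grows at least geometrically.
[cite: OConnor1975, §3 eq. (36)] -/
theorem pow_le_abs_chainD₁ {n : ℕ} {m : Fin n → ℝ} {a ω : ℝ} (hm : ∀ i, a ≤ m i)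
    (hω : 4 ≤ a * ω ^ 2) {j : ℕ} (hj : j ≤ n) :
    (a * ω ^ 2 - 3) ^ j ≤ |chainD₁ m ω j| := by
  have hq : (2 : ℝ) ≤ a * ω ^ 2 - 2 := by linarith
  have he : ∀ k, k < n → a * ω ^ 2 - 2 ≤ (fun k => -massDiag m ω k) k := by
    intro k hk
    simp only [massDiag, finExt_of_lt _ hk]
    nlinarith [hm ⟨k, hk⟩, sq_nonneg ω]
  have h := pow_le_ahD hq he j hj
  have hflip : ahD (fun k => -massDiag m ω k) 1 0 j = (-1) ^ j * chainD₁ m ω j := by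
    rw [chainD₁, ← ahD_neg_symbol (massDiag m ω) 1 0 j, neg_zero]
  rw [hflip] at h
  calc (a * ω ^ 2 - 3) ^ j = (a * ω ^ 2 - 2 - 1) ^ j := by ring
    _ ≤ (-1) ^ j * chainD₁ m ω j := h
    _ ≤ |(-1) ^ j * chainD₁ m ω j| := le_abs_self _
    _ = |chainD₁ m ω j| := by rw [abs_mul, abs_pow, abs_neg, abs_one, one_pow, one_mul]

/-- `j_n ≤ ω²/D_n(e₁)²` ("dropping positive terms from the denominator", AH2011 §2.2; O'Connor's
(33)). [cite: AjankiHuveneers2011, §2.2 (display after eq. (2.8))] -/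
theorem clCurrentDensity_le_sq_div {k : ℕ} (m : Fin (k + 1) → ℝ) (ω : ℝ)
    (hD : chainD₁ m ω (k + 1) ≠ 0) :
    clCurrentDensity m ω ≤ ω ^ 2 / chainD₁ m ω (k + 1) ^ 2 := by
  rw [clCurrentDensity_succ]
  refine div_le_div_of_nonneg_left (sq_nonneg ω) (by positivity) ?_
  nlinarith [sq_nonneg ω, sq_nonneg (chainD₁ m ω k), sq_nonneg (chainD₂ m ω (k + 1)),
    mul_nonneg (sq_nonneg ω) (add_nonneg (sq_nonneg (chainD₁ m ω k)) (sq_nonneg (chainD₂ m ω (k + 1)))),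
    mul_nonneg (by positivity : (0 : ℝ) ≤ ω ^ 4) (sq_nonneg (chainD₂ m ω k))]

/-- **Deterministic high-frequency bound**: for masses `m_k ≥ a > 0` and `aω² ≥ 6`,
`j_n(ω; m) ≤ 4/(a²ω²·9^{n-1})` (`|D_n(e₁)| ≥ (aω² - 3)^n`, `aω² - 3 ≥ max(3, aω²/2)`).
[cite: OConnor1975, §3 eq. (36)] -/
theorem clCurrentDensity_le_highFreq {k : ℕ} {m : Fin (k + 1) → ℝ} {a ω : ℝ} (ha : 0 < a)
    (hm : ∀ i, a ≤ m i) (hω : 6 ≤ a * ω ^ 2) :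
    clCurrentDensity m ω ≤ 4 / (a ^ 2 * ω ^ 2 * 9 ^ k) := by
  have hq3 : 3 ≤ a * ω ^ 2 - 3 := by linarith
  have hqh : a * ω ^ 2 / 2 ≤ a * ω ^ 2 - 3 := by linarith
  have hω2 : 0 < ω ^ 2 := by
    rcases (sq_nonneg ω).eq_or_lt with h | h
    · rw [← h, mul_zero] at hω; linarith
    · exact h
  have hpow := pow_le_abs_chainD₁ hm (by linarith) (le_refl (k + 1))
  have hpos : 0 < (a * ω ^ 2 - 3) ^ (k + 1) := by positivity
  have hD : chainD₁ m ω (k + 1) ≠ 0 := fun h => by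
    rw [h, abs_zero] at hpow
    linarith
  refine (clCurrentDensity_le_sq_div m ω hD).trans ?_
  have hsq : (a * ω ^ 2 / 2) ^ 2 * 9 ^ k ≤ chainD₁ m ω (k + 1) ^ 2 :=
    calc (a * ω ^ 2 / 2) ^ 2 * 9 ^ k ≤ (a * ω ^ 2 - 3) ^ 2 * ((a * ω ^ 2 - 3) ^ 2) ^ k := by
          gcongr
          all_goals nlinarith
      _ = ((a * ω ^ 2 - 3) ^ (k + 1)) ^ 2 := by rw [← pow_succ', ← pow_mul, ← pow_mul, Nat.mul_comm]
      _ ≤ |chainD₁ m ω (k + 1)| ^ 2 := pow_le_pow_left₀ hpos.le hpow 2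
      _ = chainD₁ m ω (k + 1) ^ 2 := sq_abs _
  calc ω ^ 2 / chainD₁ m ω (k + 1) ^ 2 ≤ ω ^ 2 / ((a * ω ^ 2 / 2) ^ 2 * 9 ^ k) :=
        div_le_div_of_nonneg_left (sq_nonneg ω) (by positivity) hsq
    _ = 4 / (a ^ 2 * ω ^ 2 * 9 ^ k) := by
        field_simp
        ring

end Growth

/-! ### The averaged tail above the band -/

section Tail

/-- The threshold `√(6/a)`: `aω² ≥ 6` for `ω ≥ √(6/a)`. [folklore] -/
theorem six_le_mul_sq {a ω : ℝ} (ha : 0 < a) (hω : Real.sqrt (6 / a) ≤ ω) : 6 ≤ a * ω ^ 2 := by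
  have h0 : 0 ≤ Real.sqrt (6 / a) := Real.sqrt_nonneg _
  have hsq : Real.sqrt (6 / a) ^ 2 = 6 / a := Real.sq_sqrt (by positivity)
  calc (6 : ℝ) = a * Real.sqrt (6 / a) ^ 2 := by rw [hsq]; field_simp
    _ ≤ a * ω ^ 2 := by
        refine mul_le_mul_of_nonneg_left (pow_le_pow_left₀ h0 hω 2) ha.le

/-- **Averaged deterministic bound**: `𝔼 j_n(ω) ≤ 4/(a²ω²9^{n-1})` for `aω² ≥ 6` when the masses
lie in `[a, b]` almost surely. [cite: OConnor1975, §3 eq. (36)] -/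
theorem clAvgCurrentDensity_le_highFreq {k : ℕ} {a b ω : ℝ} (ha : 0 < a) (ρ : Measure ℝ)
    [IsProbabilityMeasure ρ]
    (hae : ∀ᵐ m ∂(Measure.pi fun _ : Fin (k + 1) => ρ), ∀ i, a ≤ m i ∧ m i ≤ b)
    (hω : 6 ≤ a * ω ^ 2) :
    clAvgCurrentDensity ρ (k + 1) ω ≤ 4 / (a ^ 2 * ω ^ 2 * 9 ^ k) := by
  unfold clAvgCurrentDensity
  calc ∫ m, clCurrentDensity m ω ∂(Measure.pi fun _ : Fin (k + 1) => ρ)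
      ≤ ∫ _m, 4 / (a ^ 2 * ω ^ 2 * 9 ^ k) ∂(Measure.pi fun _ : Fin (k + 1) => ρ) :=
        integral_mono_ae (integrable_clCurrentDensity_left ρ (k + 1) ω) (integrable_const _)
          (hae.mono fun m hm => clCurrentDensity_le_highFreq ha (fun i => (hm i).1) hω)
    _ = 4 / (a ^ 2 * ω ^ 2 * 9 ^ k) := by simp

/-- **The tail above the band is integrable and geometrically small in `n`** (O'Connor's
`J_N(2+δ, ∞) ≤ const·e^{-½Nδ^{1/2}}`, here in the form `∫_{ω₁}^∞ 𝔼 j_n ≤ 4/(a²9^{n-1}ω₁)` for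
`aω₁² ≥ 6`). [cite: OConnor1975, §3 eq. (36)] -/
theorem clAvgCurrentDensity_tail {k : ℕ} {a b ω₁ : ℝ} (ha : 0 < a) (ρ : Measure ℝ)
    [IsProbabilityMeasure ρ]
    (hae : ∀ᵐ m ∂(Measure.pi fun _ : Fin (k + 1) => ρ), ∀ i, a ≤ m i ∧ m i ≤ b)
    (hω₁ : 0 < ω₁) (h6 : 6 ≤ a * ω₁ ^ 2) :
    IntegrableOn (clAvgCurrentDensity ρ (k + 1)) (Set.Ioi ω₁) ∧
      ∫ ω in Set.Ioi ω₁, clAvgCurrentDensity ρ (k + 1) ω ≤ 4 / (a ^ 2 * 9 ^ k) * ω₁⁻¹ := by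
  set K : ℝ := 4 / (a ^ 2 * 9 ^ k) with hK
  have hg : IntegrableOn (fun ω : ℝ => K * ω ^ (-2 : ℝ)) (Set.Ioi ω₁) :=
    (integrableOn_Ioi_rpow_of_lt (by norm_num) hω₁).const_mul K
  have hbound : ∀ ω ∈ Set.Ioi ω₁, clAvgCurrentDensity ρ (k + 1) ω ≤ K * ω ^ (-2 : ℝ) := by
    intro ω hω
    have hω0 : 0 < ω := hω₁.trans hω
    have hω6 : 6 ≤ a * ω ^ 2 :=
      h6.trans (mul_le_mul_of_nonneg_left (pow_le_pow_left₀ hω₁.le (le_of_lt hω) 2) ha.le)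
    calc clAvgCurrentDensity ρ (k + 1) ω ≤ 4 / (a ^ 2 * ω ^ 2 * 9 ^ k) :=
          clAvgCurrentDensity_le_highFreq ha ρ hae hω6
      _ = K * ω ^ (-2 : ℝ) := by
          rw [hK, Real.rpow_neg hω0.le, Real.rpow_two]
          field_simp
  have hint : IntegrableOn (clAvgCurrentDensity ρ (k + 1)) (Set.Ioi ω₁) := by
    refine Integrable.mono' hg
      (stronglyMeasurable_clAvgCurrentDensity ρ (k + 1)).aestronglyMeasurable ?_
    filter_upwards [ae_restrict_mem measurableSet_Ioi] with ω hω
    rw [Real.norm_eq_abs, abs_of_nonneg (clAvgCurrentDensity_nonneg ρ (k + 1) ω)]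
    exact hbound ω hω
  refine ⟨hint, ?_⟩
  calc ∫ ω in Set.Ioi ω₁, clAvgCurrentDensity ρ (k + 1) ω
      ≤ ∫ ω in Set.Ioi ω₁, K * ω ^ (-2 : ℝ) := setIntegral_mono_on hint hg measurableSet_Ioi hbound
    _ = K * ω₁⁻¹ := by
        rw [integral_const_mul, integral_Ioi_rpow_of_lt (by norm_num) hω₁,
          show (-2 : ℝ) + 1 = -1 by norm_num, Real.rpow_neg_one]
        ring

/-- `𝔼 j_n` is integrable on `(ω₀, ∞)` for every `ω₀ > 0` and `n ≥ 1` (bounded by `1/2` on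
`(ω₀, ω₁]`, by `4/(a²ω²)` beyond `ω₁ = max(ω₀, √(6/a))`). [cite: OConnor1975, §3 eq. (36)] -/
theorem integrableOn_clAvgCurrentDensity_Ioi {k : ℕ} {a b ω₀ : ℝ} (ha : 0 < a) (ρ : Measure ℝ)
    [IsProbabilityMeasure ρ]
    (hae : ∀ᵐ m ∂(Measure.pi fun _ : Fin (k + 1) => ρ), ∀ i, a ≤ m i ∧ m i ≤ b)
    (hω₀ : 0 < ω₀) : IntegrableOn (clAvgCurrentDensity ρ (k + 1)) (Set.Ioi ω₀) := by
  set ω₁ : ℝ := max ω₀ (Real.sqrt (6 / a)) with hω₁def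
  have h01 : ω₀ ≤ ω₁ := le_max_left _ _
  have hω₁ : 0 < ω₁ := hω₀.trans_le h01
  have h6 : 6 ≤ a * ω₁ ^ 2 := six_le_mul_sq ha (le_max_right _ _)
  have hfin : volume (Set.Ioc ω₀ ω₁) ≠ ⊤ := by
    rw [Real.volume_Ioc]
    exact ENNReal.ofReal_ne_top
  rw [← Set.Ioc_union_Ioi_eq_Ioi h01]
  exact integrableOn_union.mpr
    ⟨integrableOn_clAvgCurrentDensity ρ (k + 1) hfin, (clAvgCurrentDensity_tail ha ρ hae hω₁ h6).1⟩

end Tail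

/-! ### The band: pointwise comparison with the amplitude `t_n² = D_n(e₁)² + D_{n-1}(e₁)²` -/

section Band

/-- `t_n² = ‖Q_n e₁‖² = D_n(e₁)² + D_{n-1}(e₁)² > 0` (the two entries of a column of a matrix of
determinant `1` do not vanish together). [cite: OConnor1975, §1 eq. (4)] -/
theorem amp_pos {n : ℕ} (m : Fin n → ℝ) (ω : ℝ) (k : ℕ) :
    0 < chainD₁ m ω (k + 1) ^ 2 + chainD₁ m ω k ^ 2 := by
  have hcas := chainD_casorati m ω k
  by_contra h
  have h1 : chainD₁ m ω (k + 1) = 0 := by nlinarith [sq_nonneg (chainD₁ m ω (k + 1)), sq_nonneg (chainD₁ m ω k)]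
  have h2 : chainD₁ m ω k = 0 := by nlinarith [sq_nonneg (chainD₁ m ω (k + 1)), sq_nonneg (chainD₁ m ω k)]
  rw [h1, h2] at hcas
  simp at hcas

/-- **`j_n ≤ max(1, ω²)/t_n²`** (O'Connor's (34): "`w²j_N(w)⁻¹` is bounded either by a constant
or a multiple of `t_N(w)⁻²·max[w², …]`"): dropping the `e₂`-column terms from the denominator of
`j_n = ω²/(2ω² + D_n(e₁)² + ω²(D_{n-1}(e₁)² + D_n(e₂)²) + ω⁴D_{n-1}(e₂)²)`.
[cite: OConnor1975, §3 eq. (34)] -/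
theorem clCurrentDensity_le_max_div_amp {k : ℕ} (m : Fin (k + 1) → ℝ) (ω : ℝ) :
    clCurrentDensity m ω ≤ max 1 (ω ^ 2) / (chainD₁ m ω (k + 1) ^ 2 + chainD₁ m ω k ^ 2) := by
  have ht := amp_pos m ω k
  rcases eq_or_ne ω 0 with hω | hω
  · subst hω
    rw [clCurrentDensity_succ]
    simp only [ne_eq, OfNat.ofNat_ne_zero, not_false_eq_true, zero_pow, mul_zero, zero_add,
      zero_mul, add_zero, zero_div]
    positivity
  have hω2 : 0 < ω ^ 2 := by positivity
  set M : ℝ := max 1 (ω ^ 2) with hM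
  have hM1 : 1 ≤ M := le_max_left _ _
  have hMω : ω ^ 2 ≤ M := le_max_right _ _
  rw [clCurrentDensity_succ, div_le_div_iff₀ (by positivity) ht]
  have e1 : ω ^ 2 * chainD₁ m ω (k + 1) ^ 2 ≤ M * chainD₁ m ω (k + 1) ^ 2 :=
    mul_le_mul_of_nonneg_right hMω (sq_nonneg _)
  have e2 : ω ^ 2 * chainD₁ m ω k ^ 2 ≤ M * (ω ^ 2 * chainD₁ m ω k ^ 2) := by
    rw [← mul_assoc]
    exact mul_le_mul_of_nonneg_right (le_mul_of_one_le_left hω2.le hM1) (sq_nonneg _)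
  have e3 : M * (chainD₁ m ω (k + 1) ^ 2 + ω ^ 2 * chainD₁ m ω k ^ 2) ≤
      M * (2 * ω ^ 2 + chainD₁ m ω (k + 1) ^ 2 +
        ω ^ 2 * (chainD₁ m ω k ^ 2 + chainD₂ m ω (k + 1) ^ 2) + ω ^ 4 * chainD₂ m ω k ^ 2) := by
    refine mul_le_mul_of_nonneg_left ?_ (by positivity)
    nlinarith [sq_nonneg ω, mul_nonneg hω2.le (sq_nonneg (chainD₂ m ω (k + 1))),
      mul_nonneg (by positivity : (0 : ℝ) ≤ ω ^ 4) (sq_nonneg (chainD₂ m ω k))]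
  nlinarith [e1, e2, e3]

variable (ρ : Measure ℝ) [IsProbabilityMeasure ρ]

/-- The small-amplitude event `{t_n² ≤ E}` is measurable (closed). [folklore] -/
theorem measurableSet_amp_le (k : ℕ) (ω E : ℝ) :
    MeasurableSet {m : Fin (k + 1) → ℝ | chainD₁ m ω (k + 1) ^ 2 + chainD₁ m ω k ^ 2 ≤ E} := by
  have h1 := (continuous_chainD₁ (n := k + 1) (k + 1)).comp
    (Continuous.prodMk_left ω : Continuous fun m : Fin (k + 1) → ℝ => (m, ω))
  have h2 := (continuous_chainD₁ (n := k + 1) k).comp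
    (Continuous.prodMk_left ω : Continuous fun m : Fin (k + 1) → ℝ => (m, ω))
  exact measurableSet_le ((h1.pow 2).add (h2.pow 2)).measurable measurable_const

/-- **Band estimate from the amplitude**: splitting `𝔼 j_n(ω)` according to the event
`{t_n² ≤ E}` gives `𝔼 j_n(ω) ≤ ½·ℙ(t_n² ≤ E) + max(1, ω²)/E` (`j_n ≤ ½` always,
`j_n ≤ max(1,ω²)/t_n²` off the event). [cite: OConnor1975, §3 (end of the proof of Thm 6)] -/
theorem clAvgCurrentDensity_le_of_amp (k : ℕ) (ω : ℝ) {E : ℝ} (hE : 0 < E) :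
    clAvgCurrentDensity ρ (k + 1) ω ≤
      1 / 2 * (Measure.pi fun _ : Fin (k + 1) => ρ).real
          {m | chainD₁ m ω (k + 1) ^ 2 + chainD₁ m ω k ^ 2 ≤ E} + max 1 (ω ^ 2) / E := by
  set μ : Measure (Fin (k + 1) → ℝ) := Measure.pi fun _ : Fin (k + 1) => ρ with hμ
  set S : Set (Fin (k + 1) → ℝ) := {m | chainD₁ m ω (k + 1) ^ 2 + chainD₁ m ω k ^ 2 ≤ E} with hS
  have hSm : MeasurableSet S := measurableSet_amp_le k ω E
  have hpt : ∀ m, clCurrentDensity m ω ≤ S.indicator (fun _ => (1 / 2 : ℝ)) m + max 1 (ω ^ 2) / E := by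
    intro m
    by_cases hm : m ∈ S
    · rw [Set.indicator_of_mem hm]
      have := clCurrentDensity_le_half m ω
      have : 0 ≤ max 1 (ω ^ 2) / E := by positivity
      linarith
    · rw [Set.indicator_of_notMem hm, zero_add]
      have hlt : E < chainD₁ m ω (k + 1) ^ 2 + chainD₁ m ω k ^ 2 := lt_of_not_ge hm
      exact (clCurrentDensity_le_max_div_amp m ω).trans
        (div_le_div_of_nonneg_left (by positivity) hE hlt.le)
  have hI : Integrable (fun m => S.indicator (fun _ => (1 / 2 : ℝ)) m + max 1 (ω ^ 2) / E) μ :=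
    ((integrable_const (1 / 2 : ℝ)).indicator hSm).add (integrable_const _)
  unfold clAvgCurrentDensity
  calc ∫ m, clCurrentDensity m ω ∂μ
      ≤ ∫ m, (S.indicator (fun _ => (1 / 2 : ℝ)) m + max 1 (ω ^ 2) / E) ∂μ :=
        integral_mono (integrable_clCurrentDensity_left ρ (k + 1) ω) hI hpt
    _ = 1 / 2 * μ.real S + max 1 (ω ^ 2) / E := by
        rw [integral_add ((integrable_const (1 / 2 : ℝ)).indicator hSm) (integrable_const _),
          integral_indicator_const _ hSm, integral_const, smul_eq_mul, smul_eq_mul]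
        simp [mul_comm]

end Band

end Literature.Barriers.AtomisticToContinuum.HeatConduction

namespace Literature.Barriers.AtomisticToContinuum

open Literature.MathematicalPhysics.KineticTheory.HeatConduction HeatConduction

/-! ### O'Connor's amplitude bound (39) as a named fact -/

/-- **O'Connor's moderate-deviation bound for the amplitude `t_n = ‖A_n⋯A_1 e₁‖`** (eq. (39) of
the proof of Thm 6): for the random chain with i.i.d. masses of density `τ` (here: the standing
hypothesis `MassDensityHyp` of AH2011) and every compact frequency band `[ω₀, ω₁] ⊂ (0, ∞)` there
are `γ > 0`, `α > 0`, `C` and `N₀` such that for all `n ≥ N₀`, uniformly in `ω ∈ [ω₀, ω₁]`,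
`ℙ(t_n(ω)² ≤ e^{γn}) ≤ C e^{-α√n}`, where `t_n² = D_n(e₁)² + D_{n-1}(e₁)²`
(`A_n⋯A_1 e₁ = t_n(sin θ_n, cos θ_n)`, eq. (4); `D_j(e₁) = chainD₁`, `x_j = 2 - m_jw²`, eq. (6)).
Printed form: "`Pr[t_N² ≤ exp(½Nγ(w))] ≤ C(λ) exp[-(λ/2)N^{1/2}a(w₀)]` for `N` sufficiently
large, uniformly in `[w₀, w₁]`", `a(w₀) = min{γ(w)σ(w)⁻¹ : w ∈ [w₀, w₁]} > 0`, with `γ(w) > 0` the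
Lyapunov exponent (Thm 4 = Furstenberg's Lemma 8.9, Thm 5 = Furstenberg's criteria, the group
generated by two distinct transfer matrices being non-compact and strongly irreducible) and
`σ(w)² > 0` the CLT variance (Thms 2–3), both continuous in `w` by the norm-continuity of the
transfer operators `T(w)²`, `A(λ,w)²` (§3 (i)–(v)); the bound follows from the uniform (in
`w ∈ [w₀,w₁]`, `N` large) exponential-moment estimate (37) for `Z_N = N^{-1/2}σ⁻¹(log t_N² - Nγ)`
via (38) `Pr[Z_N(w) ≤ x] ≤ e^{-λ|x|}·(37)` for `x < 0`.
Stated here with `γ := ½ min_{[ω₀,ω₁]} γ(w)` existential (a consequence of the printed display),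
in the physical frequency of `clImpedance` (O'Connor's `w`, unit springs; his normalisation of the
masses to `≥ 1` is undone by the rescaling `(m, w) ↦ (cm, c^{-1/2}w)`, which fixes `x = 2 - mw²`).
Scope: O'Connor's hypothesis is "a C¹ density with compact support" (Thm 1 uses `μ ∈ L¹`,
Thm 2 `μ` continuous, Thm 3 `μ ∈ C¹`); AH2011 invoke Theorem 6 under the hypothesis of their
Thm 1.1 (`τ ∈ C¹([b₋,b₊])`: continuous on the support interval, `C¹` with bounded derivative
inside, continuity at the endpoints not required), and that hypothesis (`MassDensityHyp`, as in
(H)) is the one used here. Inputs NOT vendored here: Thms 1–5 of the paper.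
[cite: OConnor1975, §3 eq. (39) (proof of Thm 6) with §2 Thms 2–5 and §3 (i)–(v)] -/
def OConnor1975_amplitudeBound : Prop :=
  ∀ (τ : ℝ → ℝ) (a b : ℝ), MassDensityHyp τ a b →
    ∀ (ρ : Measure ℝ) [IsProbabilityMeasure ρ],
      ρ = volume.withDensity (fun s => ENNReal.ofReal (τ s)) →
      ∀ ω₀ ω₁ : ℝ, 0 < ω₀ → ω₀ ≤ ω₁ →
        ∃ γ : ℝ, 0 < γ ∧ ∃ α : ℝ, 0 < α ∧ ∃ C : ℝ, ∃ N₀ : ℕ, ∀ k : ℕ, N₀ ≤ k + 1 →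
          ∀ ω ∈ Set.Icc ω₀ ω₁,
            (Measure.pi fun _ : Fin (k + 1) => ρ).real
                {m | chainD₁ m ω (k + 1) ^ 2 + chainD₁ m ω k ^ 2 ≤ Real.exp (γ * ((k + 1 : ℕ) : ℝ))} ≤
              C * Real.exp (-(α * Real.sqrt ((k + 1 : ℕ) : ℝ)))

/-! ### The reduction (H) ← (39) + (36) -/

/-- `e^{s} ≤ 3·9^k` for `s ≤ k + 1` (`e ≤ 3`). [folklore] -/
theorem exp_le_three_mul_nine_pow {s : ℝ} {k : ℕ} (hs : s ≤ (k : ℝ) + 1) :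
    Real.exp s ≤ 3 * 9 ^ k := by
  have he3 : Real.exp 1 ≤ 3 := by
    have := Real.exp_one_lt_d9
    linarith
  calc Real.exp s ≤ Real.exp ((k + 1 : ℕ) * 1) := by
        refine Real.exp_le_exp.mpr ?_
        push_cast
        linarith
    _ = Real.exp 1 ^ (k + 1) := Real.exp_nat_mul 1 (k + 1)
    _ ≤ 3 ^ (k + 1) := pow_le_pow_left₀ (Real.exp_pos 1).le he3 (k + 1)
    _ = 3 * 3 ^ k := by ring
    _ ≤ 3 * 9 ^ k := by
        refine mul_le_mul_of_nonneg_left (pow_le_pow_left₀ (by norm_num) (by norm_num) k) (by norm_num)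

/-- **O'Connor's Theorem 6 in AH2011's form: (39) + (36) ⟹ (H).** For `ω₀ > 0` put
`ω₁ = max(ω₀, √(6/a))`. On the band `[ω₀, ω₁]`, `j_n ≤ ½` and `j_n ≤ max(1,ω²)/t_n²` (34) give
`𝔼 j_n(ω) ≤ ½ℙ(t_n² ≤ e^{γn}) + max(1,ω₁²)e^{-γn} ≤ ½Ce^{-α√n} + max(1,ω₁²)e^{-γn}` by (39);
above `ω₁` every chain attenuates deterministically, `∫_{ω₁}^∞ 𝔼 j_n ≤ 4/(a²ω₁9^{n-1})` (36);
the finitely many `n < N₀` are absorbed into the constant. Hence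
`∫_{ω₀}^∞ 𝔼 j_n ≤ C' e^{-c√n}` with `c = min(α, γ, 1)`, i.e. `𝒥₃ ≲ e^{-C√n}` as invoked in
AH2011 §6.2. [cite: OConnor1975, Thm 6 (proof, §3 eqs. (34), (36), (39))]
[cite: AjankiHuveneers2011, §6.2 (after eq. (6.9)) and §2 ¶3] -/
theorem AjankiHuveneers2011_highFrequencyBound_of_amplitudeBound
    (hB : OConnor1975_amplitudeBound) : AjankiHuveneers2011_highFrequencyBound := by
  intro τ a b hyp ρ _ hρ ω₀ hω₀
  have ha : 0 < a := hyp.pos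
  set ω₁ : ℝ := max ω₀ (Real.sqrt (6 / a)) with hω₁def
  have h01 : ω₀ ≤ ω₁ := le_max_left _ _
  have hω₁ : 0 < ω₁ := hω₀.trans_le h01
  have h6 : 6 ≤ a * ω₁ ^ 2 := six_le_mul_sq ha (le_max_right _ _)
  obtain ⟨γ, hγ, α, hα, C₁, N₀, hband⟩ := hB τ a b hyp ρ hρ ω₀ ω₁ hω₀ h01
  have hae : ∀ n : ℕ, ∀ᵐ m ∂(Measure.pi fun _ : Fin n => ρ), ∀ i, a ≤ m i ∧ m i ≤ b :=
    fun n => ae_pi_mem_Icc hyp.eq_zero hρ n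
  have hInt : ∀ k : ℕ, IntegrableOn (clAvgCurrentDensity ρ (k + 1)) (Set.Ioi ω₀) :=
    fun k => integrableOn_clAvgCurrentDensity_Ioi ha ρ (hae (k + 1)) hω₀
  -- the rate
  set c : ℝ := min (min α γ) 1 with hcdef
  have hc : 0 < c := lt_min (lt_min hα hγ) one_pos
  have hcα : c ≤ α := (min_le_left _ _).trans (min_le_left _ _)
  have hcγ : c ≤ γ := (min_le_left _ _).trans (min_le_right _ _)
  have hc1 : c ≤ 1 := min_le_right _ _
  -- the constant for large `n`
  set M : ℝ := max 1 (ω₁ ^ 2) with hMdef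
  set K : ℝ := (ω₁ - ω₀) * (max C₁ 0 / 2 + M) + 4 / a ^ 2 * ω₁⁻¹ * 3 with hKdef
  have hM0 : 0 ≤ M := le_trans zero_le_one (le_max_left _ _)
  have hK0 : 0 ≤ K := by
    have : 0 ≤ ω₁ - ω₀ := sub_nonneg.mpr h01
    positivity
  have hfin : volume (Set.Ioc ω₀ ω₁) ≠ ⊤ := by
    rw [Real.volume_Ioc]
    exact ENNReal.ofReal_ne_top
  -- large `n`
  have hlarge : ∀ k : ℕ, N₀ ≤ k + 1 →
      ∫ ω in Set.Ioi ω₀, clAvgCurrentDensity ρ (k + 1) ω ≤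
        K * Real.exp (-(c * Real.sqrt ((k + 1 : ℕ) : ℝ))) := by
    intro k hk
    set ν : ℝ := ((k + 1 : ℕ) : ℝ) with hνdef
    have hν : ν = (k : ℝ) + 1 := by rw [hνdef]; push_cast; ring
    have hν1 : 1 ≤ ν := by rw [hν]; linarith [(Nat.cast_nonneg k : (0 : ℝ) ≤ k)]
    have hν0 : 0 ≤ ν := zero_le_one.trans hν1
    set e : ℝ := Real.exp (-(c * Real.sqrt ν)) with hedef
    set e₁ : ℝ := Real.exp (-(α * Real.sqrt ν)) with he₁def
    set e₂ : ℝ := Real.exp (-(γ * ν)) with he₂def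
    have hsq1 : Real.sqrt ν ≤ ν := by
      rw [Real.sqrt_le_left hν0]
      nlinarith
    have he₁ : e₁ ≤ e :=
      Real.exp_le_exp.mpr (neg_le_neg (mul_le_mul_of_nonneg_right hcα (Real.sqrt_nonneg _)))
    have he₂ : e₂ ≤ e := by
      refine Real.exp_le_exp.mpr (neg_le_neg ?_)
      calc c * Real.sqrt ν ≤ γ * Real.sqrt ν := mul_le_mul_of_nonneg_right hcγ (Real.sqrt_nonneg _)
        _ ≤ γ * ν := mul_le_mul_of_nonneg_left hsq1 hγ.le
    have he₃ : (9 ^ k : ℝ)⁻¹ ≤ 3 * e := by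
      have hcs : c * Real.sqrt ν ≤ (k : ℝ) + 1 :=
        calc c * Real.sqrt ν ≤ 1 * Real.sqrt ν := mul_le_mul_of_nonneg_right hc1 (Real.sqrt_nonneg _)
          _ ≤ ν := by rw [one_mul]; exact hsq1
          _ = (k : ℝ) + 1 := hν
      have h9 := exp_le_three_mul_nine_pow hcs
      rw [hedef, Real.exp_neg, inv_le_comm₀ (by positivity) (by positivity), mul_inv, inv_inv]
      calc 3⁻¹ * Real.exp (c * Real.sqrt ν) ≤ 3⁻¹ * (3 * 9 ^ k) :=
            mul_le_mul_of_nonneg_left h9 (by norm_num)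
        _ = 9 ^ k := by ring
    -- the split
    have hIoc : IntegrableOn (clAvgCurrentDensity ρ (k + 1)) (Set.Ioc ω₀ ω₁) :=
      integrableOn_clAvgCurrentDensity ρ (k + 1) hfin
    obtain ⟨hIoi, htail⟩ := clAvgCurrentDensity_tail ha ρ (hae (k + 1)) hω₁ h6
    have hsplit : ∫ ω in Set.Ioi ω₀, clAvgCurrentDensity ρ (k + 1) ω =
        (∫ ω in Set.Ioc ω₀ ω₁, clAvgCurrentDensity ρ (k + 1) ω) +
          ∫ ω in Set.Ioi ω₁, clAvgCurrentDensity ρ (k + 1) ω := by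
      rw [← setIntegral_union Set.Ioc_disjoint_Ioi_same measurableSet_Ioi hIoc hIoi,
        Set.Ioc_union_Ioi_eq_Ioi h01]
    -- the band
    have hband' : ∀ ω ∈ Set.Ioc ω₀ ω₁,
        clAvgCurrentDensity ρ (k + 1) ω ≤ max C₁ 0 / 2 * e₁ + M * e₂ := by
      intro ω hω
      have hωmem : ω ∈ Set.Icc ω₀ ω₁ := ⟨hω.1.le, hω.2⟩
      have hS := hband k hk ω hωmem
      have hE : 0 < Real.exp (γ * ν) := Real.exp_pos _
      have hj := clAvgCurrentDensity_le_of_amp ρ k ω hE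
      have hmax : max 1 (ω ^ 2) ≤ M :=
        max_le_max le_rfl (pow_le_pow_left₀ (hω₀.le.trans hω.1.le) hω.2 2)
      calc clAvgCurrentDensity ρ (k + 1) ω
          ≤ 1 / 2 * (Measure.pi fun _ : Fin (k + 1) => ρ).real
              {m | chainD₁ m ω (k + 1) ^ 2 + chainD₁ m ω k ^ 2 ≤ Real.exp (γ * ν)} +
              max 1 (ω ^ 2) / Real.exp (γ * ν) := hj
        _ ≤ 1 / 2 * (max C₁ 0 * e₁) + M / Real.exp (γ * ν) := by
            gcongr
            exact hS.trans (mul_le_mul_of_nonneg_right (le_max_left _ _) (Real.exp_pos _).le)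
        _ = max C₁ 0 / 2 * e₁ + M * e₂ := by
            rw [he₂def, Real.exp_neg, div_eq_mul_inv]
            ring
    have hbandInt : ∫ ω in Set.Ioc ω₀ ω₁, clAvgCurrentDensity ρ (k + 1) ω ≤
        (ω₁ - ω₀) * (max C₁ 0 / 2 * e₁ + M * e₂) := by
      have h := setIntegral_mono_on hIoc (integrableOn_const hfin) measurableSet_Ioc hband'
      rwa [setIntegral_const, Real.volume_real_Ioc_of_le h01, smul_eq_mul] at h
    -- combine
    calc ∫ ω in Set.Ioi ω₀, clAvgCurrentDensity ρ (k + 1) ω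
        = (∫ ω in Set.Ioc ω₀ ω₁, clAvgCurrentDensity ρ (k + 1) ω) +
            ∫ ω in Set.Ioi ω₁, clAvgCurrentDensity ρ (k + 1) ω := hsplit
      _ ≤ (ω₁ - ω₀) * (max C₁ 0 / 2 * e₁ + M * e₂) + 4 / (a ^ 2 * 9 ^ k) * ω₁⁻¹ :=
          add_le_add hbandInt htail
      _ = (ω₁ - ω₀) * (max C₁ 0 / 2 * e₁ + M * e₂) + 4 / a ^ 2 * ω₁⁻¹ * (9 ^ k : ℝ)⁻¹ := by
          field_simp
      _ ≤ (ω₁ - ω₀) * (max C₁ 0 / 2 * e + M * e) + 4 / a ^ 2 * ω₁⁻¹ * (3 * e) := by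
          have h10 : 0 ≤ ω₁ - ω₀ := sub_nonneg.mpr h01
          gcongr
      _ = K * e := by rw [hKdef]; ring
  -- all `n`: absorb the finitely many `n < N₀`
  set I : ℕ → ℝ := fun n => ∫ ω in Set.Ioi ω₀, clAvgCurrentDensity ρ n ω with hIdef
  set C : ℝ := K + ∑ i ∈ Finset.range N₀, |I i| * Real.exp (c * Real.sqrt (i : ℝ)) with hCdef
  have hsum0 : 0 ≤ ∑ i ∈ Finset.range N₀, |I i| * Real.exp (c * Real.sqrt (i : ℝ)) :=
    Finset.sum_nonneg fun i _ => by positivity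
  have hKC : K ≤ C := le_add_of_nonneg_right hsum0
  refine ⟨C, c, hc, fun n hn => ?_⟩
  obtain ⟨k, rfl⟩ : ∃ k, n = k + 1 := ⟨n - 1, by omega⟩
  refine ⟨hInt k, ?_⟩
  by_cases hk : N₀ ≤ k + 1
  · exact (hlarge k hk).trans (mul_le_mul_of_nonneg_right hKC (Real.exp_pos _).le)
  · have hmem : k + 1 ∈ Finset.range N₀ := Finset.mem_range.mpr (lt_of_not_ge hk)
    have hterm : |I (k + 1)| * Real.exp (c * Real.sqrt ((k + 1 : ℕ) : ℝ)) ≤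
        ∑ i ∈ Finset.range N₀, |I i| * Real.exp (c * Real.sqrt (i : ℝ)) :=
      Finset.single_le_sum (f := fun i => |I i| * Real.exp (c * Real.sqrt (i : ℝ)))
        (fun i _ => by positivity) hmem
    calc I (k + 1) ≤ |I (k + 1)| := le_abs_self _
      _ = |I (k + 1)| * Real.exp (c * Real.sqrt ((k + 1 : ℕ) : ℝ)) *
            Real.exp (-(c * Real.sqrt ((k + 1 : ℕ) : ℝ))) := by
          rw [mul_assoc, ← Real.exp_add, add_neg_cancel, Real.exp_zero, mul_one]
      _ ≤ (∑ i ∈ Finset.range N₀, |I i| * Real.exp (c * Real.sqrt (i : ℝ))) *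
            Real.exp (-(c * Real.sqrt ((k + 1 : ℕ) : ℝ))) :=
          mul_le_mul_of_nonneg_right hterm (Real.exp_pos _).le
      _ ≤ C * Real.exp (-(c * Real.sqrt ((k + 1 : ℕ) : ℝ))) :=
          mul_le_mul_of_nonneg_right (le_add_of_nonneg_left hK0) (Real.exp_pos _).le

end Literature.Barriers.AtomisticToContinuum

end
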